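import Summits.KontsevichZagierPeriods.KontsevichZagierPeriods.Theses.SymplecticScissors
import Summits.KontsevichZagierPeriods.KontsevichZagierPeriods.Theorems.SymplecticScissorsTypeAGenerationRoomNormalisation
import Summits.KontsevichZagierPeriods.KontsevichZagierPeriods.Theorems.SymplecticScissorsTypeAGenerationStubBinGermMemOan
import Summits.KontsevichZagierPeriods.KontsevichZagierPeriods.Theorems.SymplecticScissorsTypeAGenerationStubBinGermCalculus
import Summits.KontsevichZagierPeriods.KontsevichZagierPeriods.Theorems.SymplecticScissorsTypeAGenerationStubBinGermValues
import Summits.KontsevichZagierPeriods.KontsevichZagierPeriods.Theorems.SymplecticScissorsTypeAGenerationStubBakerSplit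
import Summits.KontsevichZagierPeriods.KontsevichZagierPeriods.Theorems.SymplecticScissorsTypeAGenerationStubNormalForms
import Summits.KontsevichZagierPeriods.KontsevichZagierPeriods.Theorems.SymplecticScissorsTypeAGenerationStubExactDlog
import Summits.KontsevichZagierPeriods.KontsevichZagierPeriods.Theorems.SymplecticScissorsTypeAGenerationStubRootElimination
import Summits.KontsevichZagierPeriods.KontsevichZagierPeriods.Theorems.SymplecticScissorsTypeAGenerationStubPartialFractions
import Summits.KontsevichZagierPeriods.KontsevichZagierPeriods.Theorems.TypeAGeneration.Negative.HypothesesAudit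
import Literature.NumberTheory.Transcendental.AyoubPeriodSeriesLocalizing
import Literature.NumberTheory.Transcendental.AyoubPeriodSeriesDescent

/-!
# `TypeAGeneration` (stmt-KontsevichZagierPeriods-18392), line `Sketch`: LAYER 1 — Ayoub's
Conjecture 1.1 for ONE-VARIABLE RATIONAL INTEGRANDS (registered stub `stub_ratOneVarLayer`,
lead assembly, cycle 2)

**Theorem (Layer 1 of the line `Sketch`, card stokes-compiler; unconditional).** For every field
`k` of characteristic `0`, every embedding `σ : k →+* ℂ` with algebraic image, and every
`F ∈ 𝒪_{k-alg}(𝔻̄^∞)` (`AyoubRel.Oan σ`) involving one variable `zᵢ` and RATIONAL with algebraic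
coefficients (`B·F = A`, `A, B ∈ ℚ̄[zᵢ]`, `B ≠ 0`): if `∫_{[0,1]^∞} F = 0` then `F` lies in the
`k`-span of the type-(a) elements `∂G/∂zₙ − G|_{zₙ=1} + G|_{zₙ=0}`, `G ∈ 𝒪_{k-alg}(𝔻̄^∞)` — the
conclusion of the crux (Ayoub 2015 Conj. 1.1 = Fresán 2024 Conj. 3.5) on this sector.

Assembly of the cycle-2 rungs (all landed, `--supports` stmt-18392):
* PF-a `stub_rootElimination` + PF-b `stub_partialFractions_of` — normal form
  `F = P(zᵢ) + Σⱼ Σ_t c_{jt} (zᵢ − αⱼ)^{−(t+1)}` with `P ∈ ℚ̄[zᵢ]`, `αⱼ, c_{jt} ∈ ℚ̄`, `‖αⱼ‖ > 1`;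
* N1 `stub_normalForms_of` (with G1–G3) — modulo the span, `zᵢⁿ ≡ 1/(n+1)` and
  `(zᵢ − α)^{−(t+1)} ≡ κ ∈ ℚ̄` (`t ≥ 1`), so `F ≡ F′ = β + Σⱼ dⱼ/(zᵢ − αⱼ)`, `β, dⱼ ∈ ℚ̄`;
* the span integrates to zero (`TypeAGenerationNegative.intC_eq_zero_of_mem_kSpan_relAC`) and
  G3 `stub_binGermValues`: `0 = ∫ F′ = β + Σⱼ dⱼ Log(1 − αⱼ⁻¹)`;
* B1 `stub_bakerSplit` (Baker's theorem with `1`, sorry-free in the tree): `β = 0` and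
  `d = Σ_t λ_t E_t` with `λ_t ∈ ℚ̄` and EXACT integer relations `Σⱼ E_{tj} Log(1 − αⱼ⁻¹) = 0`;
* D1 `stub_exactDlog_of` (with G1–G3): each `Σⱼ E_{tj}/(zᵢ − αⱼ)` is type (a)
  (the `N`-th-root contraction);
* scalar absorption (`ℚ̄`-multiples stay in the `ℚ`-span: `c · relAC n G = relAC n (cG)`) and the
  transport `k = ℚ ⇝ (k, σ)` (`Oan_eq_Oan_rat_of_isAlgebraic`, `kSpan_rat_subset`).

This is the card's `TypeAGenerationRatOneVar`; the crux-strength residual of the line is untouched.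
References: Ayoub, Ann. of Math. 181 (2015), Conj. 1.1, Rem. 1.2, Rem. 1.5; Fresán 2024 Conj. 3.5;
Baker 1975 Thm. 2.1.
-/

noncomputable section

-- `Summit.KontsevichZagierPeriods.KontsevichZagierPeriods.…` is the tree's mandated layout (single-conjunct summit).
set_option linter.dupNamespace false

namespace Summit.KontsevichZagierPeriods.KontsevichZagierPeriods.TypeAGenerationLine

open Finsupp MvPowerSeries
open Literature.NumberTheory.Transcendental
open Literature.NumberTheory.Transcendental.AyoubRel
open Summit.KontsevichZagierPeriods.SymplecticScissors.TypeAGenerationNegative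
  (intC_eq_zero_of_mem_kSpan_relAC)

/-- The binomial germ `(1 − zᵢ/α)^a ∈ ℂ[[z]]`: Mathlib's `(1 + X)^a` (`PowerSeries.binomialSeries`)
rescaled by `X ↦ −α⁻¹ X` and renamed into the variable `zᵢ` (as `AyoubRel.perGerm`). -/
local notation3 "binGerm[" i ", " α ", " a "]" =>
  (MvPowerSeries.rename (⇑(axisEmb i))
    (PowerSeries.rescale (-(α : ℂ)⁻¹) (PowerSeries.binomialSeries ℂ (a : ℂ)) : MvPowerSeries Unit ℂ) :
    CSeries)

/-! ## Bookkeeping -/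

/-- `ℚ̄`-scalars are absorbed by the `ℚ`-span of type (a): `c · relAC n G = relAC n (c · G)`,
`c · G ∈ 𝒪_{ℚ-alg}` for `c` algebraic. [cite: Fresan2024, Conj. 3.5] -/
theorem l1_smul_mem_span {c : ℂ} (hc : IsAlgebraic ℚ c) {x : CSeries} (hx : x ∈ (kSpan (algebraMap ℚ ℂ) {x : CSeries | ∃ G ∈ Oan (algebraMap ℚ ℂ), ∃ n : ℕ, x = relAC n G})) : c • x ∈ (kSpan (algebraMap ℚ ℂ) {x : CSeries | ∃ G ∈ Oan (algebraMap ℚ ℂ), ∃ n : ℕ, x = relAC n G}) := by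
  obtain ⟨n, a, s, hs, rfl⟩ := hx
  have hc' : ∃ p : Polynomial ℚ, p ≠ 0 ∧ Polynomial.eval₂ (algebraMap ℚ ℂ) c p = 0 := by
    obtain ⟨p, hp, h⟩ := hc
    exact ⟨p, hp, h⟩
  refine ⟨n, a, fun j => c • s j, fun j => ?_, ?_⟩
  · obtain ⟨G, hG, l, hl⟩ := hs j
    exact ⟨c • G, smul_mem_Oan _ hc' hG, l, by simp only [hl, relAC_smul]⟩
  · rw [Finset.smul_sum]
    exact Finset.sum_congr rfl fun j _ => smul_comm _ _ _

/-- Finite sums of elements of the span lie in the span. [folklore] -/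
theorem l1_sum_mem_span {ι : Type*} (s : Finset ι) (v : ι → CSeries) (hv : ∀ j ∈ s, v j ∈ (kSpan (algebraMap ℚ ℂ) {x : CSeries | ∃ G ∈ Oan (algebraMap ℚ ℂ), ∃ n : ℕ, x = relAC n G})) :
    ∑ j ∈ s, v j ∈ (kSpan (algebraMap ℚ ℂ) {x : CSeries | ∃ G ∈ Oan (algebraMap ℚ ℂ), ∃ n : ℕ, x = relAC n G}) := by
  classical
  induction s using Finset.induction_on with
  | empty =>
    rw [Finset.sum_empty]
    exact s6_zero_mem_kSpan (algebraMap ℚ ℂ) _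
  | insert a s ha ih =>
    rw [Finset.sum_insert ha]
    exact kSpan_add _ (hv a (Finset.mem_insert_self a s)) (ih fun j hj => hv j (Finset.mem_insert_of_mem hj))

/-- Finite sums of algebraic numbers are algebraic. [folklore] -/
theorem l1_isAlgebraic_sum {ι : Type*} (s : Finset ι) (f : ι → ℂ) (h : ∀ j ∈ s, IsAlgebraic ℚ (f j)) :
    IsAlgebraic ℚ (∑ j ∈ s, f j) := by
  classical
  induction s using Finset.induction_on with
  | empty =>
    rw [Finset.sum_empty]
    exact isAlgebraic_zero
  | insert a s ha ih =>
    rw [Finset.sum_insert ha]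
    exact (h a (Finset.mem_insert_self a s)).add (ih fun j hj => h j (Finset.mem_insert_of_mem hj))

/-- Finite sums of absolutely summable series are absolutely summable. [folklore] -/
theorem l1_summable_sum {ι : Type*} (s : Finset ι) (f : ι → CSeries)
    (h : ∀ j ∈ s, Summable fun a : ℕ →₀ ℕ => ‖coeff a (f j)‖) :
    Summable fun a : ℕ →₀ ℕ => ‖coeff a (∑ j ∈ s, f j)‖ := by
  classical
  induction s using Finset.induction_on with
  | empty =>
    rw [Finset.sum_empty]
    exact summable_of_ne_finset_zero (s := ∅) fun a _ => by rw [map_zero, norm_zero]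
  | insert a s ha ih =>
    rw [Finset.sum_insert ha]
    exact s4_summable_norm_coeff_add (h a (Finset.mem_insert_self a s))
      (ih fun j hj => h j (Finset.mem_insert_of_mem hj))

/-- `∫ (F + G) = ∫ F + ∫ G` for absolutely summable `F`, `G` (`intC_sub`). [folklore] -/
theorem l1_intC_add {F G : CSeries} (hF : Summable fun a : ℕ →₀ ℕ => ‖coeff a F‖)
    (hG : Summable fun a : ℕ →₀ ℕ => ‖coeff a G‖) : intC (F + G) = intC F + intC G := by
  have hG' : Summable fun a : ℕ →₀ ℕ => ‖coeff a ((-1 : ℂ) • G)‖ := by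
    refine hG.congr fun a => ?_
    rw [coeff_smul, norm_mul, norm_neg, norm_one, one_mul]
  have h := intC_sub hF hG'
  rw [intC_smul, neg_one_smul, sub_neg_eq_add] at h
  rw [h]
  ring

/-- `∫ Σ Fⱼ = Σ ∫ Fⱼ` for absolutely summable `Fⱼ`. [folklore] -/
theorem l1_intC_sum {ι : Type*} (s : Finset ι) (f : ι → CSeries)
    (h : ∀ j ∈ s, Summable fun a : ℕ →₀ ℕ => ‖coeff a (f j)‖) :
    intC (∑ j ∈ s, f j) = ∑ j ∈ s, intC (f j) := by
  classical
  induction s using Finset.induction_on with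
  | empty => simp
  | insert a s ha ih =>
    rw [Finset.sum_insert ha, Finset.sum_insert ha,
      l1_intC_add (h a (Finset.mem_insert_self a s))
        (l1_summable_sum s f fun j hj => h j (Finset.mem_insert_of_mem hj)),
      ih fun j hj => h j (Finset.mem_insert_of_mem hj)]

/-- `∫ c = c` for a constant. [folklore] -/
theorem l1_intC_C (c : ℂ) : intC (C c : CSeries) = c := by
  rw [show (C c : CSeries) = c • (1 : CSeries) by rw [smul_eq_C_mul, mul_one], intC_smul, intC_one,
    mul_one]

/-- The pole germ `1/(zᵢ − α) = (−α⁻¹)(1 − zᵢ/α)⁻¹` lies in `𝒪_{ℚ-alg}(𝔻̄^∞)` (G1 at `q = −1`).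
[folklore] -/
theorem l1_poleGerm_mem_Oan (i : ℕ) {α : ℂ} (hα : IsAlgebraic ℚ α) (hα1 : 1 < ‖α‖) :
    (-α⁻¹) • binGerm[i, α, (-1 : ℂ)] ∈ Oan (algebraMap ℚ ℂ) := by
  have h := (stub_binGermMemOan i α hα hα1 (-1)).1
  rw [Rat.cast_neg, Rat.cast_one] at h
  exact smul_mem_Oan _ (g1_algebraic_neg_inv hα) h

/-- **L1 over `ℚ` — Layer 1 for `k = ℚ`**: a one-variable rational `F ∈ 𝒪_{ℚ-alg}(𝔻̄^∞)` with
algebraic coefficients and `∫ F = 0` lies in the `ℚ`-span of type (a). [cite: Ayoub2015, Conj. 1.1] -/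
theorem l1_layer_rat (i : ℕ) (F : CSeries) (hF : F ∈ Oan (algebraMap ℚ ℂ))
    (hvar : ∀ l : ℕ, UsesVar F l → l = i)
    (hrat : ∃ A B : Polynomial ℂ, B ≠ 0 ∧ (∀ n, IsAlgebraic ℚ (A.coeff n)) ∧
      (∀ n, IsAlgebraic ℚ (B.coeff n)) ∧
      Polynomial.aeval (X i : CSeries) B * F = Polynomial.aeval (X i : CSeries) A)
    (h0 : intC F = 0) : F ∈ (kSpan (algebraMap ℚ ℂ) {x : CSeries | ∃ G ∈ Oan (algebraMap ℚ ℂ), ∃ n : ℕ, x = relAC n G}) := by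
  classical
  obtain ⟨A, B, hB, hAc, hBc, hBF⟩ := hrat
  -- (1) normal form: root elimination and partial fractions
  obtain ⟨A', B', hB', hA'c, hB'c, hroots, hBF'⟩ :=
    stub_rootElimination i F hF.2.1 hvar A B hB hAc hBc hBF
  obtain ⟨P, m, M, α, c, hPc, hα, hc, hFeq⟩ :=
    stub_partialFractions_of stub_binGermCalculus i F A' B' hB' hA'c hB'c hroots hBF'
  set p : Fin m → CSeries := fun j => (-(α j)⁻¹) • binGerm[i, α j, (-1 : ℂ)] with hpdef
  have hpOan : ∀ j, p j ∈ Oan (algebraMap ℚ ℂ) := fun j => l1_poleGerm_mem_Oan i (hα j).1 (hα j).2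
  have hNF := stub_normalForms_of stub_binGermMemOan stub_binGermCalculus stub_binGermValues
  -- (2) the constants of the higher-order poles
  have hκ : ∀ (j : Fin m) (t : Fin M), ∃ κ : ℂ, IsAlgebraic ℚ κ ∧
      (1 ≤ (t : ℕ) → p j ^ ((t : ℕ) + 1) - C κ ∈ (kSpan (algebraMap ℚ ℂ) {x : CSeries | ∃ G ∈ Oan (algebraMap ℚ ℂ), ∃ n : ℕ, x = relAC n G})) := by
    intro j t
    by_cases ht : 1 ≤ (t : ℕ)
    · obtain ⟨κ, hκa, hκs⟩ := hNF.2 i (α j) (hα j).1 (hα j).2 t ht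
      exact ⟨κ, hκa, fun _ => hκs⟩
    · exact ⟨0, isAlgebraic_zero, fun h => absurd h ht⟩
  choose κ hκa hκs using hκ
  -- (3) the reduced element `F' = C β + Σ dⱼ pⱼ`
  set r : Fin m → Fin M → CSeries := fun j t =>
    if (t : ℕ) = 0 then c j t • p j else C (c j t * κ j t) with hrdef
  set d : Fin m → ℂ := fun j => ∑ t : Fin M, if (t : ℕ) = 0 then c j t else 0 with hddef
  set ε : Fin m → ℂ := fun j => ∑ t : Fin M, if (t : ℕ) = 0 then 0 else c j t * κ j t with hεdef
  set βP : ℂ := ∑ n ∈ Finset.range (P.natDegree + 1), P.coeff n * (((n : ℂ) + 1)⁻¹) with hβPdef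
  set β : ℂ := βP + ∑ j, ε j with hβdef
  set F' : CSeries := C β + ∑ j, d j • p j with hF'def
  have hr : ∀ j, ∑ t, r j t = d j • p j + C (ε j) := by
    intro j
    rw [hddef, hεdef, Finset.sum_smul, map_sum, ← Finset.sum_add_distrib]
    refine Finset.sum_congr rfl fun t _ => ?_
    simp only [hrdef]
    split_ifs with ht
    · rw [map_zero, add_zero]
    · rw [zero_smul, zero_add]
  -- (4) `F − F' ∈ (kSpan (algebraMap ℚ ℂ) {x : CSeries | ∃ G ∈ Oan (algebraMap ℚ ℂ), ∃ n : ℕ, x = relAC n G})`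
  have hPspan : Polynomial.aeval (X i : CSeries) P - C βP ∈ (kSpan (algebraMap ℚ ℂ) {x : CSeries | ∃ G ∈ Oan (algebraMap ℚ ℂ), ∃ n : ℕ, x = relAC n G}) := by
    rw [Polynomial.aeval_eq_sum_range, hβPdef, map_sum, ← Finset.sum_sub_distrib]
    refine l1_sum_mem_span _ _ fun n _ => ?_
    rw [map_mul, ← smul_eq_C_mul, ← smul_sub]
    exact l1_smul_mem_span (hPc n) (hNF.1 i n)
  have hterm : ∀ j t, c j t • p j ^ ((t : ℕ) + 1) - r j t ∈ (kSpan (algebraMap ℚ ℂ) {x : CSeries | ∃ G ∈ Oan (algebraMap ℚ ℂ), ∃ n : ℕ, x = relAC n G}) := by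
    intro j t
    simp only [hrdef]
    split_ifs with ht
    · rw [ht, zero_add, pow_one, sub_self]
      exact s6_zero_mem_kSpan (algebraMap ℚ ℂ) _
    · rw [map_mul, ← smul_eq_C_mul, ← smul_sub]
      exact l1_smul_mem_span (hc j t) (hκs j t (Nat.one_le_iff_ne_zero.mpr ht))
  have hFF' : F - F' = (Polynomial.aeval (X i : CSeries) P - C βP) +
      ∑ j, ∑ t, (c j t • p j ^ ((t : ℕ) + 1) - r j t) := by
    have e1 : ∑ j, ∑ t, (c j t • p j ^ ((t : ℕ) + 1) - r j t) =
        (∑ j, ∑ t, c j t • p j ^ ((t : ℕ) + 1)) - ∑ j, (d j • p j + C (ε j)) := by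
      rw [← Finset.sum_sub_distrib]
      refine Finset.sum_congr rfl fun j _ => ?_
      rw [Finset.sum_sub_distrib, hr j]
    rw [e1, hF'def, hβdef, Finset.sum_add_distrib, hFeq]
    simp only [hpdef, map_add, map_sum]
    abel
  have hFF'span : F - F' ∈ (kSpan (algebraMap ℚ ℂ) {x : CSeries | ∃ G ∈ Oan (algebraMap ℚ ℂ), ∃ n : ℕ, x = relAC n G}) := by
    rw [hFF']
    exact kSpan_add _ hPspan (l1_sum_mem_span _ _ fun j _ => l1_sum_mem_span _ _ fun t _ => hterm j t)
  -- (5) `∫ F' = 0` and its value `β + Σ dⱼ Log(1 − αⱼ⁻¹)`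
  have hF'0 : intC F' = 0 := by
    have h := intC_sub (summable_norm_coeff_of_mem_Oan (algebraMap ℚ ℂ) hF)
      (summable_norm_coeff_of_mem_kSpan_relAC (algebraMap ℚ ℂ) hFF'span)
    rw [sub_sub_cancel, h0, intC_eq_zero_of_mem_kSpan_relAC (algebraMap ℚ ℂ) hFF'span, sub_zero] at h
    exact h
  -- algebraicity of the scalars
  have hdalg : ∀ j, IsAlgebraic ℚ (d j) := fun j =>
    l1_isAlgebraic_sum _ _ fun t _ => by
      split_ifs
      · exact hc j t
      · exact isAlgebraic_zero
  have hεalg : ∀ j, IsAlgebraic ℚ (ε j) := fun j =>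
    l1_isAlgebraic_sum _ _ fun t _ => by
      split_ifs
      · exact isAlgebraic_zero
      · exact (hc j t).mul (hκa j t)
  have hβalg : IsAlgebraic ℚ β := by
    refine (l1_isAlgebraic_sum _ _ fun n _ => (hPc n).mul ?_).add
      (l1_isAlgebraic_sum _ _ fun j _ => hεalg j)
    exact ((isAlgebraic_nat n).add isAlgebraic_one).inv
  have hdp : ∀ j, d j • p j ∈ Oan (algebraMap ℚ ℂ) := fun j =>
    smul_mem_Oan _ (by obtain ⟨q, hq, h⟩ := hdalg j; exact ⟨q, hq, h⟩) (hpOan j)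
  have hCβ : Summable fun a : ℕ →₀ ℕ => ‖coeff a (C β : CSeries)‖ := by
    simpa only [MvPolynomial.coe_C] using s4_summable_norm_coeff_coe (MvPolynomial.C β)
  have hu : ∀ j, (1 : ℂ) - (α j)⁻¹ ≠ 0 := by
    intro j h
    have h1 : ‖(α j)⁻¹‖ < 1 := by
      rw [norm_inv]; exact inv_lt_one_of_one_lt₀ (hα j).2
    rw [sub_eq_zero] at h
    rw [← h, norm_one] at h1
    exact lt_irrefl _ h1
  have hval : intC F' = β + ∑ j, d j * Complex.log (1 - (α j)⁻¹) := by
    rw [hF'def, l1_intC_add hCβ (l1_summable_sum _ _ fun j _ =>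
      summable_norm_coeff_of_mem_Oan (algebraMap ℚ ℂ) (hdp j)), l1_intC_C,
      l1_intC_sum _ _ fun j _ => summable_norm_coeff_of_mem_Oan (algebraMap ℚ ℂ) (hdp j)]
    congr 1
    refine Finset.sum_congr rfl fun j _ => ?_
    rw [intC_smul]
    simp only [hpdef]
    rw [(stub_binGermValues i (α j) (hα j).2).2]
  -- (6) Baker: `β = 0`, `d = Σ λ_t E_t` with exact integer relations
  have hexp : ∀ j, IsAlgebraic ℚ (Complex.exp (Complex.log (1 - (α j)⁻¹))) := by
    intro j
    rw [Complex.exp_log (hu j)]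
    exact isAlgebraic_one.sub (hα j).1.inv
  have hrelation : β + ∑ j, d j * Complex.log (1 - (α j)⁻¹) = 0 := by rw [← hval, hF'0]
  obtain ⟨hβ0, r', lam, E, hlam, hrel, hdE⟩ :=
    stub_bakerSplit m _ d β hexp hdalg hβalg hrelation
  -- (7) `F' ∈ (kSpan (algebraMap ℚ ℂ) {x : CSeries | ∃ G ∈ Oan (algebraMap ℚ ℂ), ∃ n : ℕ, x = relAC n G})` by D1 on each exact relation
  have hF'span : F' ∈ (kSpan (algebraMap ℚ ℂ) {x : CSeries | ∃ G ∈ Oan (algebraMap ℚ ℂ), ∃ n : ℕ, x = relAC n G}) := by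
    have e : F' = ∑ t, lam t • ∑ j, (E t j : ℂ) • p j := by
      rw [hF'def, hβ0, map_zero, zero_add]
      simp_rw [Finset.smul_sum, smul_smul]
      rw [Finset.sum_comm]
      refine Finset.sum_congr rfl fun j _ => ?_
      rw [hdE j, Finset.sum_smul]
    rw [e]
    refine l1_sum_mem_span _ _ fun t _ => l1_smul_mem_span (hlam t) ?_
    have h := stub_exactDlog_of stub_binGermMemOan stub_binGermCalculus stub_binGermValues i m α
      (E t) hα (hrel t)
    simpa only [hpdef] using h
  -- (8) `F = (F − F') + F'`
  have h := kSpan_add _ hFF'span hF'span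
  rwa [sub_add_cancel] at h

/-- **L1 (lead assembly) — LAYER 1: Ayoub's Conjecture 1.1 for ONE-VARIABLE RATIONAL integrands.**
For every `σ : k →+* ℂ` with algebraic image and every `F ∈ 𝒪_{k-alg}(𝔻̄^∞)` in one variable `zᵢ`
which is rational with algebraic coefficients (`B·F = A`, `A, B ∈ ℚ̄[zᵢ]`, `B ≠ 0`):
`∫ F = 0 ⟹ F ∈ ⟨a⟩_k`. Assembly: PF-a, PF-b (normal form `P + Σ c_{jt} (zᵢ − αⱼ)^{−(t+1)}`),
N1 (reduce to `β + Σⱼ cⱼ/(zᵢ − αⱼ)` modulo the span, `β ∈ ℚ̄`), G3 (`∫ = β + Σ cⱼ Log(1 − αⱼ⁻¹)`),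
B1 (Baker: `β = 0`, `c = Σ λ_t E_t` with exact integer relations), D1 (each `Σⱼ E_{tj}/(zᵢ − αⱼ)`
is type (a)), scalar absorption of `ℚ̄` and transport `k = ℚ ⇝ (k, σ)`. The card's
`TypeAGenerationRatOneVar`. [cite: Ayoub2015, Conj. 1.1] -/
theorem stub_ratOneVarLayer :
    ∀ (k : Type) [Field k] [CharZero k] (σ : k →+* ℂ), (∀ c : k, IsAlgebraic ℚ (σ c)) →
      ∀ (i : ℕ) (F : CSeries), F ∈ Oan σ → (∀ l : ℕ, UsesVar F l → l = i) →
        (∃ A B : Polynomial ℂ, B ≠ 0 ∧ (∀ n, IsAlgebraic ℚ (A.coeff n)) ∧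
          (∀ n, IsAlgebraic ℚ (B.coeff n)) ∧
          Polynomial.aeval (X i : CSeries) B * F = Polynomial.aeval (X i : CSeries) A) →
        intC F = 0 → F ∈ kSpan σ {x : CSeries | ∃ G ∈ Oan σ, ∃ n : ℕ, x = relAC n G} := by
  intro k _ _ σ halg i F hF hvar hrat h0
  rw [Oan_eq_Oan_rat_of_isAlgebraic σ halg] at hF ⊢
  exact kSpan_rat_subset σ _ (l1_layer_rat i F hF hvar hrat h0)


end Summit.KontsevichZagierPeriods.KontsevichZagierPeriods.TypeAGenerationLine
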